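import Summits.CriticalPhenomena.CardyFormulaZ2.Theorems.CardyIKTransportIKMixedBoxCrossingDefectGlueColDefs

/-!
# Line `defect-closure-exploration`, reshape v4 (lead c4) — VOCABULARY + COMPOSITION of the YANG–BAXTER
# TRANSPORT of the vertical clause of the crux `IKMixedBoxCrossing` (stmt-CriticalPhenomena-5911)

Definitions-only support file, companion of `…DefectDefs.lean` (p97097), `…DefectGlueDefs.lean` (p116391),
`…DefectGlueColDefs.lean` (p121256).  Nothing is asserted: every `def … : Prop` is a statement the LINE POSITS (a
registered stub or glue), never a literature fact; the compositions are sorry-free.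

THE RESHAPE (v4).  The column exchange of the sibling crux `IKLinearTransport` is an EXACT symmetry of this crux's own
model on CYLINDERS, connectivity included: `DiagramExchangeAt L` (Theorems/…IKLinearTransportLine.lean, LANDED as
`stub_DiagramExchange`, p91210) says that on the three-column cylinder block `Fin 3 × ℤ/L` the diagram-resolved
transfer weight of (honeycomb, isotropic) equals that of (isotropic, honeycomb), for every pair of boundary
colourings and every boundary connectivity diagram.  Consequences drawn here (lead c4 memo
`Cruxes/IKMixedBoxCrossing/Lines/defect-closure-exploration-c4.md`; exact-enumeration checks of the whole chain in the
lead's folder `compute/exchange/`):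
* `CylExchange` — on the cylinder slab `Fin (w+1) × ℤ/L` with face types `τ : Fin w → Bool`, the probability of any
  event determined by the data off an interior cell column and by the block diagram around it is unchanged when the
  two face types adjacent to that column are swapped (algebra over `DiagramExchangeAt`);
* `SlabDeterminacy` — black connectivity inside the slab between cells off the column is such an event (every black
  path splits into off-column pieces and block-internal pieces between block-boundary cells);
* `CylBunching` — hence `cylArcs w L τ n` (two antipodal arcs of the left column joined by a black path inside the
  slab) is invariant under permutations of `τ`; bunching the majority type at the left end and restricting to it
  (monotone) bounds it below by the same quantity for a PURE slab (all honeycomb or all isotropic) of half the width;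
* `CylPlane` — a black path between the two arcs crosses one of the two antipodal `2n`-bands of the cylinder of
  circumference `8n`; the cylinder law is rotation invariant; and on events of a band at distance `≥ 3n` from the seam
  the cylinder law and the planar free box law agree up to the factor `(1 ± ρ^{3n})^{2k} ≤ 2` (row-chain `L∞` mixing):
  `cylArcs (n-1) (8n) (τ_S) n ≤ 4 · pTB S a b n (2n)`;
* so the VERTICAL clause of the crux FOR EVERY PATTERN `S` follows from two single-model cylinder statements:
  `TriCylArcs` (site percolation on `𝕋`: tree RSW `exists_rsw_const` + Harris, provable) and `UnivCylArcs` (the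
  isotropic Izergin–Korepin model: OPEN — the one RSW-without-FKG statement left, free of pattern uniformity);
* the HORIZONTAL clause for every `S` stays on the landed column junction (`ColGluing`, p121636) and the open
  `ContactSecondMomentCol` (transport does not reach it: no exchange-invariant event bounds a planar left–right
  crossing from below).
`verticalFloor_of`, `pureIK_of_transport`, `mixed_of_transport` and the registered compositions are sorry-free.

DISPROOF USED (`Cruxes/IKMixedBoxCrossing/Disproof.lean` v5): `iKMixedBoxCrossing_false_without_n_pos` (`1 ≤ n` kept
everywhere), `c_le_quarter` (constants existential), `colourField_not_positivelyAssociated` (association is used ONLY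
for the pure honeycomb slab, which is i.i.d.).  No `def` below restates a landed Negative lemma or the negatives index.
-/

noncomputable section

namespace Summit.CriticalPhenomena.CardyFormulaZ2.Cruxes.IKMixedBoxCrossing.DefectClosureExploration

open scoped BigOperators Classical ENNReal NNReal
open MeasureTheory Finset
open Literature.Probability.Percolation Literature.Probability.LatticeModels
open Summit.CriticalPhenomena.CardyFormulaZ2.Theorems.IKLinearTransport.PinnedDiagramExchange
  (Ω μIK Obs obs νmix lrCross tbCross faceWeight blockDiagram DiagramExchangeAt)
open Summit.CriticalPhenomena.CardyFormulaZ2.Cruxes.IKMixedBoxCrossing.PairedMirrorExploration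
  (pLR pTB PatternLocality QuarterTurn Monotone' univ_recentre pLR_two_mul_eq_pH pTB_two_mul_eq_pV)
open Summit.CriticalPhenomena.CardyFormulaZ2.Theorems.IKMixedBoxCrossing

/-! ## §1 Cylinder slabs `Fin (w+1) × ℤ/L` (cell columns `0 … w`, face columns `0 … w-1`, rows periodic) -/

/-- Configurations of the cylinder slab with `w` face columns: colours of the cells `Fin (w+1) × ℤ/L` and
anti-diagonal flags of the faces `Fin w × ℤ/L` (face `(j, r)` has corners `(j,r), (j+1,r), (j,r+1), (j+1,r+1)`). -/
abbrev CylCfg (w L : ℕ) : Type := (Fin (w + 1) × ZMod L → Bool) × (Fin w × ZMod L → Bool)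

/-- Parity of a face of the slab (odd number of black corners; same formula as `faceOdd`). -/
def cylFaceOdd {w L : ℕ} (col : Fin (w + 1) × ZMod L → Bool) (f : Fin w × ZMod L) : Bool :=
  (col (f.1.castSucc, f.2) ^^ col (f.1.succ, f.2)) ^^ (col (f.1.castSucc, f.2 + 1) ^^ col (f.1.succ, f.2 + 1))

/-- Weight of a slab configuration for the face types `τ` (`τ j = true`: face column `j` isotropic): the product of
the local face weights `faceWeight` of the sibling vocabulary (isotropic: `(√3/2)^[odd] / 2`; honeycomb: `[anti]`). -/
def cylWeight (w L : ℕ) [NeZero L] (τ : Fin w → Bool) (x : CylCfg w L) : ℝ :=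
  ∏ f : Fin w × ZMod L, faceWeight (τ f.1) (cylFaceOdd x.1 f) (x.2 f)

/-- Partition function of the slab. -/
def cylZ (w L : ℕ) [NeZero L] (τ : Fin w → Bool) : ℝ := ∑ x : CylCfg w L, cylWeight w L τ x

/-- Probability of an event of slab configurations under the normalised weights (the free corner-fugacity field
of the cylinder slab together with its diagonals). -/
def cylProb (w L : ℕ) [NeZero L] (τ : Fin w → Bool) (E : Set (CylCfg w L)) : ℝ :=
  (∑ x : CylCfg w L, if x ∈ E then cylWeight w L τ x else 0) / cylZ w L τ

/-- The triangulation of the slab read from the flags (verbatim `blockGraph` with `Fin 2 / Fin 3` replaced by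
`Fin w / Fin (w+1)`): vertical and horizontal nearest neighbours, the main diagonal `(j,r) — (j+1,r+1)` of the face
`(j,r)` when its flag is `false`, the anti-diagonal `(j,r+1) — (j+1,r)` when it is `true`. -/
def cylGraph (w L : ℕ) (flg : Fin w × ZMod L → Bool) : SimpleGraph (Fin (w + 1) × ZMod L) :=
  SimpleGraph.fromRel fun x y =>
    (y.1 = x.1 ∧ y.2 = x.2 + 1) ∨ (y.1.val = x.1.val + 1 ∧ y.2 = x.2) ∨
    (∃ j : Fin w, x.1 = j.castSucc ∧ y.1 = j.succ ∧ y.2 = x.2 + 1 ∧ flg (j, x.2) = false) ∨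
    (∃ j : Fin w, x.1 = j.castSucc ∧ y.1 = j.succ ∧ x.2 = y.2 + 1 ∧ flg (j, y.2) = true)

/-- Black connectivity inside the slab: both cells black and joined by a path of black cells of the slab. -/
def BlackConn {w L : ℕ} (x : CylCfg w L) (u v : Fin (w + 1) × ZMod L) : Prop :=
  ∃ hu : x.1 u = true, ∃ hv : x.1 v = true,
    ((cylGraph w L x.2).induce {z | x.1 z = true}).Reachable ⟨u, hu⟩ ⟨v, hv⟩

/-- THE TRANSPORTED EVENT `arcsEvent w L n`: a cell of the left column with row in `[n, 3n)` and one with row in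
`[5n, 7n)` (antipodal arcs when `L = 8n`) are joined by a black path inside the slab. -/
def arcsEvent (w L n : ℕ) : Set (CylCfg w L) :=
  {x | ∃ r₁ r₂ : ZMod L, n ≤ (r₁.val : ℕ) ∧ r₁.val < 3 * n ∧ 5 * n ≤ r₂.val ∧ r₂.val < 7 * n ∧
    BlackConn x ((0 : Fin (w + 1)), r₁) ((0 : Fin (w + 1)), r₂)}

/-- Its probability. -/
def cylArcs (w L : ℕ) [NeZero L] (τ : Fin w → Bool) (n : ℕ) : ℝ := cylProb w L τ (arcsEvent w L n)

/-- The face types of the planar box `[a, a+w+1) × …` read from the column pattern `S`: face column `a + j`. -/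
def τOf (S : Set ℤ) (a : ℤ) (w : ℕ) : Fin w → Bool := fun j => decide (a + (j : ℕ) ∈ S)

/-! ## §2 The block around an interior cell column and events determined off it -/

/-- The three-column block of the slab at face columns `i, i+1` (cell columns `i, i+1, i+2`), as a colouring of
`Fin 3 × ℤ/L` (the sibling vocabulary's block). Requires `i + 1 < w`. -/
def blockCol {w L : ℕ} (i : ℕ) (hi : i + 1 < w) (x : CylCfg w L) : Fin 3 × ZMod L → Bool :=
  fun c => x.1 (⟨i + c.1.val, by have := c.1.isLt; omega⟩, c.2)

/-- The flags of the two face columns `i, i+1` of the block, as flags of `Fin 2 × ℤ/L`. -/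
def blockFlg {w L : ℕ} (i : ℕ) (hi : i + 1 < w) (x : CylCfg w L) : Fin 2 × ZMod L → Bool :=
  fun f => x.2 (⟨i + f.1.val, by have := f.1.isLt; omega⟩, f.2)

/-- The boundary connectivity diagram of the block (the sibling vocabulary's `blockDiagram`). -/
def blockDiag {w : ℕ} (L : ℕ) (i : ℕ) (hi : i + 1 < w) (x : CylCfg w L) :
    Set ((Fin 2 × ZMod L) × (Fin 2 × ZMod L)) :=
  blockDiagram L (blockCol i hi x) (blockFlg i hi x)

/-- `E` is DETERMINED OFF THE CELL COLUMN `i+1` (given the block diagram): two configurations with the same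
colours off cell column `i+1`, the same flags off face columns `i, i+1` and the same block diagram agree on `E`. -/
def OffColDetermined (w L : ℕ) (i : ℕ) (hi : i + 1 < w) (E : Set (CylCfg w L)) : Prop :=
  ∀ x y : CylCfg w L,
    (∀ c : Fin (w + 1) × ZMod L, c.1.val ≠ i + 1 → x.1 c = y.1 c) →
    (∀ f : Fin w × ZMod L, f.1.val ≠ i → f.1.val ≠ i + 1 → x.2 f = y.2 f) →
    blockDiag L i hi x = blockDiag L i hi y → (x ∈ E ↔ y ∈ E)

/-- Swap of the two face types `i, i+1`. -/
def τSwap {w : ℕ} (i : ℕ) (hi : i + 1 < w) (τ : Fin w → Bool) : Fin w → Bool :=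
  τ ∘ Equiv.swap (⟨i, by omega⟩ : Fin w) ⟨i + 1, hi⟩

/-! ## §3 Stub statements of the reshape v4 -/

/-- CYLINDER EXCHANGE (from the landed `DiagramExchangeAt`, algebra only): swapping two adjacent face types of
different kind does not change the probability of an event determined off the cell column between them. (The slab
weight factorises as (faces left of `i`) × (block weight of faces `i, i+1`) × (faces right of `i+1`); summing the
block weight over the middle column and the block flags with the diagram fixed is `pinnedWeight`, symmetric by
`DiagramExchangeAt L`; the partition functions agree for the same reason.) Size M.
  A statement to be proved (registered stub), not asserted here. -/
def CylExchange : Prop :=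
  ∀ (w L : ℕ) [NeZero L], 3 ≤ L → ∀ (τ : Fin w → Bool) (i : ℕ) (hi : i + 1 < w),
    τ ⟨i, by omega⟩ ≠ τ ⟨i + 1, hi⟩ → ∀ E : Set (CylCfg w L), OffColDetermined w L i hi E →
      cylProb w L τ E = cylProb w L (τSwap i hi τ) E

/-- SLAB DETERMINACY (combinatorics of paths): black connectivity inside the slab between two cells off the cell
column `i+1` is determined off that column given the block diagram (a black path splits at its visits to the block
into pieces off the column and block-internal pieces between block-boundary cells, which the diagram records; the
converse re-assembles). Stated for the transported event. Size M.
  A statement to be proved (registered stub), not asserted here. -/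
def SlabDeterminacy : Prop :=
  ∀ (w L n : ℕ) (i : ℕ) (hi : i + 1 < w), OffColDetermined w L i hi (arcsEvent w L n)

/-- CYLINDER BUNCHING: the arcs probability of ANY slab of `w` face columns is at least the smaller of the two PURE
arcs probabilities at `w / 2` face columns (same circumference). (Permute the face types by adjacent transpositions
— `CylExchange` + `SlabDeterminacy`, equal types swap trivially — so that the majority type occupies the face columns
`0 … m-1`, `m ≥ w/2`; a black path inside the sub-slab of the first `w/2` face columns is a path inside the slab; the
slab law restricted to a left sub-slab is the sub-slab law (the face kernels are doubly stochastic); a pure sub-slab's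
law is the pure law.) Size M–L.
  A statement to be proved (registered stub), not asserted here. -/
def CylBunching : Prop :=
  ∀ (w L n : ℕ) [NeZero L], 3 ≤ L → ∀ τ : Fin w → Bool,
    min (cylArcs (w / 2) L (fun _ => false) n) (cylArcs (w / 2) L (fun _ => true) n) ≤ cylArcs w L τ n

/-- CYLINDER ↔ PLANE: `cylArcs (n-1) (8n) (τ_S a) n ≤ 4 · P_S[TB crossing of the n × 2n box at (a, b)]`.
((i) a black path from a row in `[n,3n)` to a row in `[5n,7n)` crosses the band `[3n,5n)` or the band `[7n,8n) ∪ [0,n)`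
bottom-to-top (rows move by ≤ 1 per step); (ii) the slab law is invariant under the rotation `r ↦ r + 4n`, which swaps
the two bands; (iii) the slab law conditioned on its two seam rows is the planar free box law of `[a,a+n) × [b, b+8n)`
conditioned on its bottom and top rows, and for an event of the rows `[3n,5n)` that conditional probability is within the
factor `(1+ρ^{3n})^{2k}/(1-ρ^{8n-1})^k ≤ 2` of the unconditional one (the `d`-step row kernel is `2^{-n} ∏_iso (1 ± ρ^d)`);
(iv) the planar free box probability of the band crossing is `pTB S a (b+3n) n (2n) = pTB S a b n (2n)` (gauge bridge,
pattern locality).) Size L.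
  A statement to be proved (registered stub), not asserted here. -/
def CylPlane : Prop :=
  ∀ (S : Set ℤ) (n : ℕ) (a b : ℤ) (L : ℕ) [NeZero L], 1 ≤ n → L = 8 * n →
    cylArcs (n - 1) L (τOf S a (n - 1)) n ≤ 4 * pTB S a b n (2 * n)

/-- TRIANGULAR CYLINDER ARCS (site percolation on `𝕋`, the all-honeycomb slab: i.i.d. fair colours, anti-diagonals):
the two antipodal arcs of the left column of the slab of `⌈n/2⌉` columns on the cylinder of circumference `8n` are
joined inside the slab with probability bounded below (LR crossings of `[0,⌈n/2⌉) × [2n,3n)` and `× [5n,6n)`, a TB crossing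
of the right half of the slab over `[2n,6n)`, Harris–Kleitman for the uniform measure, tree RSW `exists_rsw_const` via
`pLR_empty`/`pTB_empty`). Size L.
  A statement to be proved (registered stub), not asserted here. -/
def TriCylArcs : Prop :=
  ∃ c : ℝ, 0 < c ∧ ∀ (n L : ℕ) [NeZero L], 1 ≤ n → L = 8 * n → c ≤ cylArcs ((n - 1) / 2) L (fun _ => false) n

/-- ISOTROPIC CYLINDER ARCS (THE OPEN RESIDUE of the vertical clause, isotropic model ONLY): the same bound for the
all-isotropic slab — RSW for the isotropic Izergin–Korepin cell model in cylinder form. No positive association is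
available (Disproof §4); squares of the planar model are crossed with probability `½` exactly; the cylinder law is
rotation- and reflection-invariant.
  A statement to be proved (registered stub), not asserted here. -/
def UnivCylArcs : Prop :=
  ∃ c : ℝ, 0 < c ∧ ∀ (n L : ℕ) [NeZero L], 1 ≤ n → L = 8 * n → c ≤ cylArcs ((n - 1) / 2) L (fun _ => true) n

/-! ## §4 Compositions (sorry-free) -/

/-- **The vertical clause for EVERY pattern** from the transport stubs: `P_S[TB(n × 2n)] ≥ min(c_𝕋, c_iso)/4`. -/
theorem verticalFloor_of (hB : CylBunching) (hP : CylPlane) (hT : TriCylArcs) (hU : UnivCylArcs) :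
    ∃ c : ℝ, 0 < c ∧ ∀ (S : Set ℤ) (n : ℕ) (a b : ℤ), 1 ≤ n → c ≤ pTB S a b n (2 * n) := by
  obtain ⟨ct, hct, ht⟩ := hT
  obtain ⟨cu, hcu, hu⟩ := hU
  refine ⟨min ct cu / 4, by positivity, fun S n a b hn => ?_⟩
  haveI : NeZero (8 * n) := ⟨by omega⟩
  have h8 : 3 ≤ 8 * n := by omega
  have hplane := hP S n a b (8 * n) hn rfl
  have hbunch := hB (n - 1) (8 * n) n h8 (τOf S a (n - 1))
  have htri := ht n (8 * n) hn rfl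
  have huniv := hu n (8 * n) hn rfl
  have hmin : min ct cu ≤ min (cylArcs ((n - 1) / 2) (8 * n) (fun _ => false) n)
      (cylArcs ((n - 1) / 2) (8 * n) (fun _ => true) n) := min_le_min htri huniv
  linarith [hmin.trans hbunch]

/-- **`PureIKBoxCrossing` from the vertical floor** (no `sorry`): the vertical clause is the floor itself (gauge
bridge); the horizontal clause of an isotropic-pure `2n × n` box is, by free locality, the isotropic one, i.e. by the
quarter turn a vertical clause at the origin. -/
theorem pureIK_of_transport (hBr : GaugeBridge) (hL : PatternLocality) (hQ : QuarterTurn) (hF : FreeLocality)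
    (hV : ∃ c : ℝ, 0 < c ∧ ∀ (S : Set ℤ) (n : ℕ) (a b : ℤ), 1 ≤ n → c ≤ pTB S a b n (2 * n)) :
    PureIKBoxCrossing := by
  obtain ⟨c, hc, hfl⟩ := hV
  refine ⟨c, hc, fun S n a b hn => ⟨fun hS => ?_, fun _ => ?_⟩⟩
  · have hS' : ∀ x : ℤ, a ≤ x → x + 1 < a + ((2 * n : ℕ) : ℤ) → x ∈ S := fun x h1 h2 =>
      hS x h1 (by push_cast at h2; linarith)
    rw [(hF S a b (2 * n) n hS').1, ← (hBr Set.univ n a b).1, ← pLR_two_mul_eq_pH,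
      (univ_recentre hL a b (2 * n) n).1]
    have hq : pTB Set.univ 0 0 n (2 * n) = pLR Set.univ 0 0 (2 * n) n := by
      rw [hQ n (2 * n), (univ_recentre hL _ _ (2 * n) n).1]
    rw [← hq]
    exact hfl Set.univ n 0 0 hn
  · rw [← (hBr S n a b).2, ← pTB_two_mul_eq_pV]
    exact hfl S n a b hn

/-- **`MixedBoxCrossingFree` — the crux for EVERY pattern — from the vertical floor (transport) and the column
junction with the uniform column contact inequality** (no `sorry`; the horizontal half is `mixed_of`'s verbatim). -/
theorem mixed_of_transport (hBr : GaugeBridge) (hL : PatternLocality) (hM : Monotone') (hCG : ColGluing)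
    (hC : ContactSecondMomentCol)
    (hV : ∃ c : ℝ, 0 < c ∧ ∀ (S : Set ℤ) (n : ℕ) (a b : ℤ), 1 ≤ n → c ≤ pTB S a b n (2 * n)) :
    MixedBoxCrossingFree := by
  obtain ⟨Cc, hCc, hc⟩ := hC
  obtain ⟨cv, hcv, hv⟩ := hV
  refine ⟨min cv (1 / Cc), lt_min hcv (by positivity), fun S n a b hn => ⟨?_, ?_⟩⟩
  · set S' : Set ℤ := {x | x + (a + n) ∈ S} with hS'
    obtain ⟨hD, hN⟩ := hc S' n b hn
    have hfl := floor_of_moments hCc measureReal_nonneg (hCG S' b n n) hD hN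
    rw [nuMix_real_lrCross] at hfl
    have hpat : ∀ i : ℕ, i < 2 * n → (a + i ∈ S ↔ -(n : ℤ) + i ∈ S') := fun i _ => by
      simp only [hS', Set.mem_setOf_eq]
      rw [show -(n : ℤ) + i + (a + n) = a + i by ring]
    rw [← (hBr S n a b).1, ← pLR_two_mul_eq_pH, (hL S S' a (-(n : ℤ)) b b (2 * n) n hpat).1]
    have hmono : pLR S' (-(n : ℤ)) b (2 * n + 1) n ≤ pLR S' (-(n : ℤ)) b (2 * n) n :=
      hM.1 S' (-(n : ℤ)) b (2 * n) (2 * n + 1) n (by omega) (by omega)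
    exact (min_le_right _ _).trans (hfl.trans hmono)
  · rw [← (hBr S n a b).2, ← pTB_two_mul_eq_pV]
    exact (min_le_left _ _).trans (hv S n a b hn)

/-! ## §5 Registered stubs of the reshape v4 (name-keyed aliases) and the registered compositions -/

namespace Registered

/-- Alias keyed by the registered stub name. -/
abbrev stub_cylExchange : Prop := CylExchange
/-- Alias keyed by the registered stub name. -/
abbrev stub_slabDeterminacy : Prop := SlabDeterminacy
/-- Alias keyed by the registered stub name. -/
abbrev stub_cylBunch : Prop := CylExchange → SlabDeterminacy → CylBunching
/-- Alias keyed by the registered stub name. -/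
abbrev stub_cylPlane : Prop := CylPlane
/-- Alias keyed by the registered stub name. -/
abbrev stub_triCylArcs : Prop := TriCylArcs
/-- Alias keyed by the registered stub name (OPEN). -/
abbrev stub_univCylArcs : Prop := UnivCylArcs

end Registered

/-- **The vertical floor from the registered transport stubs** (registered composition). -/
theorem verticalFloor_of_stubs :
    Registered.stub_cylExchange → Registered.stub_slabDeterminacy → Registered.stub_cylBunch →
      Registered.stub_cylPlane → Registered.stub_triCylArcs → Registered.stub_univCylArcs →
      ∃ c : ℝ, 0 < c ∧ ∀ (S : Set ℤ) (n : ℕ) (a b : ℤ), 1 ≤ n → c ≤ pTB S a b n (2 * n) :=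
  fun hX hD hB hP hT hU => verticalFloor_of (hB hX hD) hP hT hU

/-- **`PureIKBoxCrossing` from the registered transport stubs and the landed structure** (registered composition). -/
theorem pureIK_of_transportStubs :
    GaugeBridge → PatternLocality → QuarterTurn → FreeLocality →
      Registered.stub_cylExchange → Registered.stub_slabDeterminacy → Registered.stub_cylBunch →
      Registered.stub_cylPlane → Registered.stub_triCylArcs → Registered.stub_univCylArcs → PureIKBoxCrossing :=
  fun hBr hL hQ hF hX hD hB hP hT hU =>
    pureIK_of_transport hBr hL hQ hF (verticalFloor_of_stubs hX hD hB hP hT hU)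

/-- **`MixedBoxCrossingFree` from the registered transport stubs, the landed column junction and the uniform column
contact inequality** (registered composition). -/
theorem mixing_of_transportStubs :
    GaugeBridge → PatternLocality → Monotone' → Registered.stub_colFactorisation → Registered.stub_colGlue →
      Registered.stub_csmCol →
      Registered.stub_cylExchange → Registered.stub_slabDeterminacy → Registered.stub_cylBunch →
      Registered.stub_cylPlane → Registered.stub_triCylArcs → Registered.stub_univCylArcs →
      MixedBoxCrossingFree :=
  fun hBr hL hM hCF hCG hC hX hD hB hP hT hU =>
    mixed_of_transport hBr hL hM (hCG hCF) hC (verticalFloor_of_stubs hX hD hB hP hT hU)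

end Summit.CriticalPhenomena.CardyFormulaZ2.Cruxes.IKMixedBoxCrossing.DefectClosureExploration

end
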